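import Literature.AnabelianGeometry.EtaleTheta.Discharge.Sec5Prop53

/-!
# [EtTh] §5, Proposition 5.3 (ii), (iii): a NON-VACUOUS instance form — "`Ψ^Φ_{A_⊚}` preserves the isomorphisms
# pinned by the prime log-divisors" — valid when the primary components `Φ(A_⊚)_𝔭` are PERFECT (rows F-0562, F-0559)

Mochizuki, *The étale theta function and its Frobenioid-theoretic manifestations*, Publ. RIMS **45** (2009), §5,
Prop. 5.3 (ii), (iii), p. 325 (PDF p. 99): `Ψ^Φ_{A_⊚}` preserves "the natural isomorphisms between distinct
non-cuspidal [resp. cuspidal] primary components of `Φ(A_⊚)` [cf. Remark 3.8.2]", these being "determined by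
identifying the elements on each side that arise from [scheme-theoretic] prime log-divisors" (p. 325)
[cite: MochizukiEtTh2009, Prop 5.3 (ii) p.325 (PDF p.99)]; Prop. 5.1 p. 323 (PDF p. 97): the divisor monoid `Φ(−)`
of the §5 Frobenioid is **perfect**; Prop. 3.2 (i) p. 296 (PDF p. 70): "a direct product of copies of `ℚ_{≥0}`".
Cell abc-iut, block F, seat abc-iut-f-128 (tranche 128: rows F-0562 `PreservesNcspComponentIsos`, F-0563, F-0564).
PROOF-ONLY companion (no `def`, no instance, nothing landed is edited) of abc-iut-L2-t4's `FrobenioidThetaDivisors.lean`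
and abc-iut-L2-d4's `Discharge/Sec5Prop53.lean`.

WHY.  The instance forms OF RECORD of F-0562 / F-0559 — abc-iut-L2-d4's `preservesNcspComponentIsos_of_monoidTypeZ`
/ `preservesCspComponentIsos_of_monoidTypeZ`, indexed as `N_EtTh_Prop5_3_ii/iii` — carry the hypothesis
`hN : ∀ 𝔭, Nonempty (𝔭.submonoid ≃* Multiplicative ℕ)` ("monoid type `ℤ`"), which abc-iut-f-127 proved
UNSATISFIABLE whenever `Φ(A_⊚)` is perfect (`DivisorPrimeData.not_monoidTypeZHyp_of_isPerfect`, p434934,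
`Sec5Prop53PerfectVacuity.lean`) — and Prop. 5.1 says it is.  When `Φ(A_⊚)_𝔭 ≅ ℚ_{≥0}` there are `ℚ_{>0}`-many
isomorphisms `Φ(A_⊚)_𝔭 ⥲ Φ(A_⊚)_𝔮`; print PINS one by the prime log-divisors.  This file types that reading:

* **coordinates** `φ_𝔭 : Φ(A_⊚)_𝔭 ↪ L` on the primary components (injective maps to one fixed type `L`; e.g.
  `Φ(A_⊚)_𝔭 = ℚ_{≥0} · gen_𝔭 ⥲ ℚ_{≥0}`, the coefficient of the prime log-divisor `gen_𝔭`);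
* the natural isomorphisms `ι_{𝔭,𝔮} : Φ(A_⊚)_𝔭 ⥲ Φ(A_⊚)_𝔮` are **coordinate-preserving** (`hiso`: "identifying the
  elements … that arise from prime log-divisors" — `r · gen_𝔭 ↦ r · gen_𝔮`);
* `Ψ^Φ_{A_⊚}` is **coordinate-preserving** on each component (`hψ`: it carries `r · gen_𝔭` to `r · gen_{Ψ^Φ 𝔭}`, i.e.
  prime log-divisors to prime log-divisors — [EtTh] Cor. 3.8 (iii), [FrdI] Thm. 4.9).

RESULT.  `apply_componentIso_eq_of_coordinates`: under these hypotheses `Ψ^Φ ∘ ι_{𝔭,𝔮} = ι_{Ψ^Φ𝔭,Ψ^Φ𝔮} ∘ Ψ^Φ` on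
`Φ(A_⊚)_𝔭` (two elements of `Φ(A_⊚)_{Ψ^Φ𝔮}` with the same coordinate are equal).  Hence the instance forms
**`preservesNcspComponentIsos_of_coordinates`** (row F-0562) and **`preservesCspComponentIsos_of_coordinates`**
(row F-0559), valid for PERFECT components, for `ℤ_{≥0}`-components, for any `L`.  They SUBSUME the forms of record:
under monoid type `ℤ` every choice of coordinates `Φ(A_⊚)_𝔭 ⥲ ℤ_{≥0}` makes `hiso`, `hψ` automatic
(`coordinatesPreserved_of_monoidTypeZ`, via L2-d4's `mulEquiv_eq_of_equiv_nat`), whence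
`preservesNcspComponentIsos_of_monoidTypeZ'` / `preservesCspComponentIsos_of_monoidTypeZ'` re-derive L2-d4's
theorems from the new ones.  NON-VACUITY at print's (perfect) shape: abc-iut-f-009's toy `Φ = ⊕_{ℤ ⊔ ℤ} ℚ_{≥0}`
(`Sec5Prop53Toy.lean`, p431742) with the canonical isomorphisms `canonIso` and any re-indexing `e = reindex σ` meets
`hiso`/`hψ` with `φ_𝔭 :=` the `idx 𝔭`-coordinate (this seat's `Sec5Prop53ChainModel.lean`, `reindex_canonIso`).

HONEST FRAMING: kernel-checked implications about the TYPED data; which isomorphisms print's "natural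
isomorphisms" are is recorded as the hypothesis `hiso`, not decided; typed ≠ proved; no side taken on [IUTchIII]
Cor. 3.12 or on any author.
-/

namespace Literature.AnabelianGeometry.EtaleTheta

open CategoryTheory
open Literature.AlgebraicGeometry.Frobenioids

universe w v v' u u'

namespace FrobenioidThetaDivisors

/-! ### The core computation: coordinate-preserving maps commute -/

section Coordinates

variable {Φ : Type w} [CommMonoid Φ] {L : Type*}

/-- **Two component isomorphisms pinned by coordinates commute with a coordinate-preserving automorphism.**  For a
monoid automorphism `ψ` of `Φ`, injective coordinates `φ_𝔭 : Φ_𝔭 → L` on the primary components, a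
coordinate-preserving `j : Φ_𝔭 ⥲ Φ_𝔮`, a coordinate-preserving `j' : Φ_{ψ𝔭} ⥲ Φ_{ψ𝔮}`, and `ψ` coordinate-preserving
on `Φ_𝔭` and `Φ_𝔮`: `ψ (j x) = j' (ψ x)` for all `x ∈ Φ_𝔭` ("identifying the elements on each side that arise from
prime log-divisors", p.325 (PDF p.99)). [cite: MochizukiEtTh2009, Prop 5.3 (ii) p.325 (PDF p.99)] -/
theorem apply_componentIso_eq_of_coordinates (ψ : Φ ≃* Φ) (φ : ∀ 𝔭 : Primes Φ, ↥𝔭.submonoid → L)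
    (hφ : ∀ 𝔭, Function.Injective (φ 𝔭)) {p q : Primes Φ} (j : ↥p.submonoid ≃* ↥q.submonoid)
    (hj : ∀ x, φ q (j x) = φ p x)
    (j' : ↥(Primes.congr ψ p).submonoid ≃* ↥(Primes.congr ψ q).submonoid) (hj' : ∀ y, φ _ (j' y) = φ _ y)
    (hψp : ∀ x : ↥p.submonoid, φ _ (Primes.submonoidCongr ψ p _ rfl x) = φ p x)
    (hψq : ∀ x : ↥q.submonoid, φ _ (Primes.submonoidCongr ψ q _ rfl x) = φ q x) (x : ↥p.submonoid) :
    ψ (j x : Φ) = (j' (Primes.submonoidCongr ψ p _ rfl x) : Φ) :=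
  congrArg Subtype.val
    (show Primes.submonoidCongr ψ q _ rfl (j x) = j' (Primes.submonoidCongr ψ p _ rfl x) from
      hφ _ (by rw [hψq, hj, hj', hψp]))

/-- Under "monoid type `ℤ`" (every `Φ_𝔭 ≅ ℤ_{≥0}`) ANY isomorphism between primary components preserves ANY system of
coordinates `φ_𝔭 : Φ_𝔭 ⥲ ℤ_{≥0}` (there is exactly one isomorphism `ℤ_{≥0} ⥲ ℤ_{≥0}`; abc-iut-L2-d4's
`mulEquiv_eq_of_equiv_nat`). [cite: MochizukiEtTh2009, Prop 5.3 (ii) p.325 (PDF p.99)] -/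
theorem coordinatesPreserved_of_monoidTypeZ (φ : ∀ 𝔭 : Primes Φ, ↥𝔭.submonoid ≃* Multiplicative ℕ)
    {p q : Primes Φ} (j : ↥p.submonoid ≃* ↥q.submonoid) (x : ↥p.submonoid) : φ q (j x) = φ p x := by
  have h : j.trans (φ q) = φ p := mulEquiv_eq_of_equiv_nat (φ p) (MulEquiv.refl _) _ _
  exact MulEquiv.congr_fun h x

end Coordinates

/-! ### Proposition 5.3 (ii), (iii) for coordinate-pinned natural isomorphisms -/

section Prop53

variable {C : Type u} [Category.{v} C] {D : Type u'} [Category.{v'} D] {𝔉 : ThetaFrobenioid.{w} C D}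
  (𝔓 : DivisorPrimeData 𝔉) (Ψ : C ≌ C) (ι : Ψ.functor.obj 𝔉.Acirc ≅ 𝔉.Acirc)
  (e : 𝔉.PhiAcirc ≃* 𝔉.pre.Mon (𝔉.base.obj (Ψ.functor.obj 𝔉.Acirc))) {L : Type*}

/-- **[EtTh] Prop. 5.3 (ii), NON-VACUOUS INSTANCE FORM (row F-0562)**: if the natural isomorphisms between non-cuspidal
primary components are the ones pinned by injective coordinates `φ_𝔭 : Φ(A_⊚)_𝔭 ↪ L` ("identifying the elements …
that arise from prime log-divisors", `hiso`) and `Ψ^Φ_{A_⊚}` preserves the coordinates on every component (`hψ`: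
prime log-divisors go to prime log-divisors), then `Ψ^Φ_{A_⊚}` is compatible with these isomorphisms — for PERFECT
components (`Φ(A_⊚)_𝔭 ≅ ℚ_{≥0}`, Prop. 5.1 / Prop. 3.2 (i)) as well as for `ℤ_{≥0}`-components.
[cite: MochizukiEtTh2009, Prop 5.3 (ii) p.325 (PDF p.99)] -/
theorem preservesNcspComponentIsos_of_coordinates (hc : CuspPreserved 𝔓 Ψ ι e)
    (φ : ∀ 𝔭 : Primes 𝔉.PhiAcirc, ↥𝔭.submonoid → L) (hφ : ∀ 𝔭, Function.Injective (φ 𝔭))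
    (hiso : ∀ (p q : Primes 𝔉.PhiAcirc) (hp : ¬ 𝔓.IsCuspidal p) (hq : ¬ 𝔓.IsCuspidal q) (x : ↥p.submonoid),
      φ q (𝔓.ncspIso p q hp hq x) = φ p x)
    (hψ : ∀ (p : Primes 𝔉.PhiAcirc) (x : ↥p.submonoid),
      φ _ (Primes.submonoidCongr (psiPhi 𝔉 Ψ ι e) p _ rfl x) = φ p x) :
    PreservesNcspComponentIsos 𝔓 Ψ ι e hc :=
  fun p q hp hq _ x => apply_componentIso_eq_of_coordinates (psiPhi 𝔉 Ψ ι e) φ hφ (𝔓.ncspIso p q hp hq)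
    (hiso p q hp hq) _ (hiso _ _ _ _) (hψ p) (hψ q) x

/-- **[EtTh] Prop. 5.3 (iii), NON-VACUOUS INSTANCE FORM (row F-0559)**: the same for the natural isomorphisms between
cuspidal primary components ("all the cusps of `Ÿ^log` arise from `K̈`-rational points … the cuspidal version of
Remark 3.8.2", p.325 (PDF p.99)). [cite: MochizukiEtTh2009, Prop 5.3 (iii) p.325 (PDF p.99)] -/
theorem preservesCspComponentIsos_of_coordinates (hc : CuspPreserved 𝔓 Ψ ι e)
    (φ : ∀ 𝔭 : Primes 𝔉.PhiAcirc, ↥𝔭.submonoid → L) (hφ : ∀ 𝔭, Function.Injective (φ 𝔭))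
    (hiso : ∀ (p q : Primes 𝔉.PhiAcirc) (hp : 𝔓.IsCuspidal p) (hq : 𝔓.IsCuspidal q) (x : ↥p.submonoid),
      φ q (𝔓.cspIso p q hp hq x) = φ p x)
    (hψ : ∀ (p : Primes 𝔉.PhiAcirc) (x : ↥p.submonoid),
      φ _ (Primes.submonoidCongr (psiPhi 𝔉 Ψ ι e) p _ rfl x) = φ p x) :
    PreservesCspComponentIsos 𝔓 Ψ ι e hc :=
  fun p q hp hq _ x => apply_componentIso_eq_of_coordinates (psiPhi 𝔉 Ψ ι e) φ hφ (𝔓.cspIso p q hp hq)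
    (hiso p q hp hq) _ (hiso _ _ _ _) (hψ p) (hψ q) x

/-- The coordinate form SUBSUMES the instance form of record for (ii): under "monoid type `ℤ`" (`hN`), any choice of
coordinates `Φ(A_⊚)_𝔭 ⥲ ℤ_{≥0}` satisfies `hiso` and `hψ` automatically, re-deriving abc-iut-L2-d4's
`preservesNcspComponentIsos_of_monoidTypeZ`. [cite: MochizukiEtTh2009, Prop 5.3 (ii) p.325 (PDF p.99)] -/
theorem preservesNcspComponentIsos_of_monoidTypeZ' (hc : CuspPreserved 𝔓 Ψ ι e)
    (hN : ∀ 𝔭 : Primes 𝔉.PhiAcirc, Nonempty (↥𝔭.submonoid ≃* Multiplicative ℕ)) :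
    PreservesNcspComponentIsos 𝔓 Ψ ι e hc :=
  let φ : ∀ 𝔭 : Primes 𝔉.PhiAcirc, ↥𝔭.submonoid ≃* Multiplicative ℕ := fun 𝔭 => Classical.choice (hN 𝔭)
  preservesNcspComponentIsos_of_coordinates 𝔓 Ψ ι e hc (fun 𝔭 => φ 𝔭) (fun 𝔭 => (φ 𝔭).injective)
    (fun p q hp hq x => coordinatesPreserved_of_monoidTypeZ φ (𝔓.ncspIso p q hp hq) x)
    (fun _ x => coordinatesPreserved_of_monoidTypeZ φ _ x)

/-- The coordinate form SUBSUMES the instance form of record for (iii) (re-deriving abc-iut-L2-d4's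
`preservesCspComponentIsos_of_monoidTypeZ`). [cite: MochizukiEtTh2009, Prop 5.3 (iii) p.325 (PDF p.99)] -/
theorem preservesCspComponentIsos_of_monoidTypeZ' (hc : CuspPreserved 𝔓 Ψ ι e)
    (hN : ∀ 𝔭 : Primes 𝔉.PhiAcirc, Nonempty (↥𝔭.submonoid ≃* Multiplicative ℕ)) :
    PreservesCspComponentIsos 𝔓 Ψ ι e hc :=
  let φ : ∀ 𝔭 : Primes 𝔉.PhiAcirc, ↥𝔭.submonoid ≃* Multiplicative ℕ := fun 𝔭 => Classical.choice (hN 𝔭)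
  preservesCspComponentIsos_of_coordinates 𝔓 Ψ ι e hc (fun 𝔭 => φ 𝔭) (fun 𝔭 => (φ 𝔭).injective)
    (fun p q hp hq x => coordinatesPreserved_of_monoidTypeZ φ (𝔓.cspIso p q hp hq) x)
    (fun _ x => coordinatesPreserved_of_monoidTypeZ φ _ x)

end Prop53

end FrobenioidThetaDivisors

end Literature.AnabelianGeometry.EtaleTheta
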